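import Mathlib
import Literature.Combinatorics.Enumerative.DerivativePolynomialGeneratingFunctions
import HarnessLib

/-!
# Arnol'd's snakes of types `Bₙ` and `βₙ` are counted by `Qₙ(1)` and `Pₙ(1)` (Hoffman 1999, Theorem 4.2)

Topic `Combinatorics/Enumerative`, namespace `Literature.Combinatorics.Enumerative.Snakes`.  Continues
`DerivativePolynomialGeneratingFunctions.lean` (Hoffman's `P(u,t)`, `Q(u,t)`, `Pₙ(1) = 2ⁿEₙ`, the recurrences of
`Pₙ(1)`, `Qₙ(1)`) and `AlternatingPermutations.lean` (`zigzagWord`, `arrangements`, `Eₙ = eulerZigzag n`).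
Definitions: `signings`, `signedArrangements S` (integer words `x` with `{|x₁|,…,|xₙ|} = S`, each once),
`betaSnakes S`, `bSnakes S` (Arnol'd's snakes of types `β` and `B` on a set `S` of absolute values),
`signedSet`, and the bookkeeping of the cut (`signedMax`, `negIfOdd`, `leftPiece`, `rightPiece`); everything
else PROVED; no named fact, no `sorry`, no instance, no notation.

## Source, verbatim

M. E. Hoffman, *Derivative polynomials, Euler polynomials, and associated integer sequences*, Electron. J.
Combin. 6 (1999) #R21 [Hoffman1999DerivativePolynomials] (held `paper:doi-10-37236-1453`), §4, pp. 6–8: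

> «By describing Springer numbers geometrically in terms of Weyl chambers, Arnol'd [3] showed that the
> numbers aₙ, bₙ, and dₙ can be thought of as counting various types of snakes (updown sequences). The formal
> definitions are as follows. Definition. A snake of type Aₙ is a sequence (x₀, x₁, …, xₙ) of integers such
> that x₀ < x₁ > x₂ < ⋯ xₙ and {x₀, x₁, …, xₙ} = {0, 1, …, n}. A snake of type Bₙ is a sequence (x₁, x₂, …, xₙ)
> of integers such that 0 < x₁ > x₂ < ⋯ xₙ and {|x₁|, |x₂|, …, |xₙ|} = {1, 2, …, n}. […] an integer sequence
> (x₁, …, xₙ) such that x₁ < x₂ > x₃ < ⋯ xₙ and {|x₁|, …, |xₙ|} = {1, …, n} is called a snake of type βₙ.»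
> «Theorem 4.2. Let b(t) = Σ_{n≥0} card Bₙ tⁿ/n! and β(t) = Σ_{n≥0} card βₙ tⁿ/n!. Then b(t) = Q(1,t) and
> β(t) = P(1,t) (so card Bₙ = Qₙ(1) and card βₙ = Pₙ(1)).
> Proof. We prove the formula for β(t) first. Given (x₁, …, x_{n+1}) ∈ β_{n+1}, let r be the unique element of
> {0, …, n} with |x_{r+1}| = n + 1. Then the sets {|x₁|, …, |x_r|} and {|x_{r+2}|, …, |x_{n+1}|} partition
> {1, …, n}. The sequence (x₁, …, x_r) can be shrunk into a snake of type β_r […]; similarly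
> ((−1)^{r+1}x_{r+2}, …, (−1)^{r+1}x_{n+1}) gives a snake of type β_{n−r}. Conversely […]. Hence
> card β_{n+1} = Σ_{r=0}^{n} binom(n,r) card β_r card β_{n−r} + δ_{n0}, from which follows β′(t) = β(t)² + 1.
> (The Kronecker delta term reflects the fact that there are two β₁-snakes, (1) and (−1).) The unique solution
> of this differential equation satisfying the initial condition β(0) = card β₀ = 1 (β₀ consists of the empty
> snake) is β(t) = tan(t + π/4) = (tan t + 1)/(1 − tan t) = P(1,t).
> Now suppose (x₁, …, x_{n+1}) ∈ B_{n+1}, with r ∈ {0, …, n} such that |x_{r+1}| = n + 1. Again the sequences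
> (x₁, …, x_r) and (x_{r+2}, …, x_{n+1}) consist of integers whose absolute values partition {1, …, n}. The
> sequence (x₁, …, x_r) can be shrunk into a B_r-snake, since x₁ > 0; but the shrinkage of the sequence
> ((−1)^r x_{r+2}, …, (−1)^r x_{n+1}) is a snake of type β_{n−r}. Hence card B_{n+1} = Σ_{r=0}^{n} binom(n,r)
> card B_r card β_{n−r} and we have b′(t) = b(t)β(t). Using b(0) = 1 and our formula for β(t), this gives
> b(t) = (1/√2) sec(t + π/4) = Q(1,t).»
> «equation (5) above implies card βₙ = 2ⁿa_{n−1}, which has a simple combinatorial interpretation in terms of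
> snakes (cf. Theorem 24 of [3]).»  ([3] = V. I. Arnol'd, Russian Math. Surveys 47 (1992) 1–51 [Arnold1992Snakes].)

## What is formalized (snakes on an ARBITRARY finite set `S ∌ 0` of absolute values, so no «shrinking»)

* §1 `signings`, `signedArrangements S` with `mem_signedArrangements` (`(x.map |·|)` lists `S` once each),
  `betaSnakes S` (`x₁ < x₂ > ⋯`), `bSnakes S` (`0 < x₁ > x₂ < ⋯`), small enumerations (`1, 3, 11` / `2, 4, 16`;
  `B₂ = {(2,1), (2,−1), (1,−2)}`).
* §2 ★★ the sign-pattern decomposition `signedArrangements S = ⨆_{N ⊆ S} arrangements(signedSet S N)` and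
  **`card β(S) = 2^{|S|}E_{|S|}`** (Arnol'd's Theorem 24 / Hoffman's remark) from the tree's
  `card_filter_arrangements_zigzagWord`; hence ★★★ **Theorem 4.2 (β)** `card βₙ = Pₙ(1)` via (5), and
  Hoffman's recurrence `card β_{n+1} = Σ binom(n,r) card β_r card β_{n−r} + δ_{n0}` recovered.
* §3 the cut lemmas: a reverse alternating word cut at its least letter (`|u|` even, `v` alternating) and at
  its greatest letter (`|u|` odd, `v` reverse alternating; by negation from the tree's
  `zigzagWord_append_cons_iff`).
* §4 ★★★ **Theorem 4.2 (B), the printed bijection** `card_bSnakes_eq_sum`: cutting a snake of type `B` on `S`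
  at the letter `±M` of greatest absolute value gives (snake of type `B` on `T`, snake of type `β` on
  `S ∖ {M} ∖ T`) after the sign normalisation `(−1)^r` of the right piece — `+M` sits at a peak (`r` even),
  `−M` at a valley (`r` odd); `Finset.card_bij'` with explicit inverse.
* §5 ★★★ **`card B(S) = Q_{|S|}(1)`** for every `S ∌ 0` (strong induction with `Q_{n+1}(1) = Σ binom(n,k)Qₖ(1)
  2^{n−k}E_{n−k}`), `card Bₙ = Qₙ(1)` on `{1,…,n}`, the printed recurrence, ★★ the generating functions
  `b(t) = Q(1,t)`, `β(t) = P(1,t)` as identities in `ℚ⟦t⟧`, and the values `1, 1, 3, 11, 57, 361, 2763, 24611` /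
  `1, 2, 4, 16, 80, 512, 3904`.

DEVIATION from the printed proof, said plainly: for type `β` we do not formalize Hoffman's cut bijection but
count directly by sign patterns (`2^{|S|}E_{|S|}`, the «simple combinatorial interpretation» Hoffman points to)
and use (5); the type-`B` count follows the printed cut exactly.  NOT typed here: snakes of types `Aₙ` (these
are the tree's alternating permutations, `eulerZigzag`) and `Dₙ` and Theorem 4.3 (`card βₙ = card Bₙ + card Dₙ`),
Springer's Weyl-group definition `M(R)`, Proposition 4.4.
-/

namespace Literature.Combinatorics.Enumerative
namespace Snakes

open List
open Literature.ComputerArithmetic.BrentZimmermann2010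

/-! ### §1 Signed arrangements of a set of absolute values -/

/-- All ways of putting signs on the letters of a word of natural numbers: `signings [a, b] =
[[a, b], [−a, b], [a, −b], [−a, −b]]` (as integers).
[cite: Hoffman1999DerivativePolynomials, §4 Definition («a sequence (x₁, …, xₙ) of integers such that … {|x₁|, …, |xₙ|} = {1, …, n}»)] -/
def signings : List ℕ → List (List ℤ)
  | [] => [[]]
  | a :: w => (signings w).flatMap fun v => [(a : ℤ) :: v, -(a : ℤ) :: v]

/-- `x` is a signing of `w` iff taking absolute values letterwise gives back `w`.
[cite: Hoffman1999DerivativePolynomials, §4 Definition («{|x₁|, …, |xₙ|} = {1, …, n}»)] -/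
theorem mem_signings {w : List ℕ} {x : List ℤ} : x ∈ signings w ↔ x.map Int.natAbs = w := by
  induction w generalizing x with
  | nil => cases x <;> simp [signings]
  | cons a w ih =>
      cases x with
      | nil => simp [signings]
      | cons c x =>
          simp only [signings, mem_flatMap, mem_cons, not_mem_nil, or_false, map_cons, cons.injEq]
          constructor
          · rintro ⟨v, hv, h | h⟩ <;> obtain ⟨rfl, rfl⟩ := h <;> simp [ih.1 hv]
          · rintro ⟨hc, hx⟩
            refine ⟨x, ih.2 hx, ?_⟩
            rcases Int.natAbs_eq c with h | h <;> rw [hc] at h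
            · exact Or.inl ⟨h, rfl⟩
            · exact Or.inr ⟨h, rfl⟩

/-- **Signed arrangements** of a finite set `S ⊂ ℕ` of absolute values: the integer words `(x₁, …, xₙ)` with
`{|x₁|, …, |xₙ|} = S`, each absolute value used once (`n = |S|`).
[cite: Hoffman1999DerivativePolynomials, §4 Definition (snakes of types Bₙ, βₙ: «{|x₁|, |x₂|, …, |xₙ|} = {1, 2, …, n}»)] -/
def signedArrangements (S : Finset ℕ) : Finset (List ℤ) :=
  (arrangements S).biUnion fun w => (signings w).toFinset

/-- Membership in the signed arrangements: the word of absolute values lists `S` once each.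
[cite: Hoffman1999DerivativePolynomials, §4 Definition («{|x₁|, …, |xₙ|} = {1, …, n}»)] -/
theorem mem_signedArrangements {S : Finset ℕ} {x : List ℤ} :
    x ∈ signedArrangements S ↔ (x.map Int.natAbs).Nodup ∧ (x.map Int.natAbs).toFinset = S := by
  rw [signedArrangements, Finset.mem_biUnion]
  constructor
  · rintro ⟨w, hw, hx⟩
    rw [mem_toFinset, mem_signings] at hx
    rw [hx]
    exact mem_arrangements.1 hw
  · intro h
    exact ⟨_, mem_arrangements.2 h, by rw [mem_toFinset, mem_signings]⟩

/-- The **snakes of type `βₙ`** on a set `S` of absolute values (Arnol'd): signed arrangements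
`x₁ < x₂ > x₃ < ⋯` of `S`. [cite: Hoffman1999DerivativePolynomials, §4 («an integer sequence (x₁, …, xₙ) such that x₁ < x₂ > x₃ < ⋯ xₙ and {|x₁|, …, |xₙ|} = {1, …, n} is called a snake of type βₙ»); Arnold1992Snakes] -/
def betaSnakes (S : Finset ℕ) : Finset (List ℤ) :=
  (signedArrangements S).filter fun x => zigzagWord true x = true

/-- The **snakes of type `Bₙ`** on a set `S` of absolute values (Arnol'd): signed arrangements with
`0 < x₁ > x₂ < x₃ > ⋯`, i.e. `0 x₁ x₂ ⋯` is reverse alternating.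
[cite: Hoffman1999DerivativePolynomials, §4 Definition («A snake of type Bₙ is a sequence (x₁, x₂, …, xₙ) of integers such that 0 < x₁ > x₂ < ⋯ xₙ and {|x₁|, |x₂|, …, |xₙ|} = {1, 2, …, n}»); Arnold1992Snakes] -/
def bSnakes (S : Finset ℕ) : Finset (List ℤ) :=
  (signedArrangements S).filter fun x => zigzagWord true (0 :: x) = true

/-- Small cases by enumeration: on the absolute values `{1}`, `{1,2}`, `{1,2,3}` there are `1, 3, 11` snakes of
type `B` and `2, 4, 16` of type `β` («there are two β₁-snakes, (1) and (−1)»).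
[cite: Hoffman1999DerivativePolynomials, §4 proof of Theorem 4.2 («there are two β₁-snakes, (1) and (−1)»)] -/
theorem snakes_small_counts :
    (((List.range' 1 1).permutations'.flatMap signings).countP fun x => zigzagWord true (0 :: x)) = 1 ∧
    (((List.range' 1 2).permutations'.flatMap signings).countP fun x => zigzagWord true (0 :: x)) = 3 ∧
    (((List.range' 1 3).permutations'.flatMap signings).countP fun x => zigzagWord true (0 :: x)) = 11 ∧
    (((List.range' 1 1).permutations'.flatMap signings).countP fun x => zigzagWord true x) = 2 ∧
    (((List.range' 1 2).permutations'.flatMap signings).countP fun x => zigzagWord true x) = 4 ∧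
    (((List.range' 1 3).permutations'.flatMap signings).countP fun x => zigzagWord true x) = 16 := by
  refine ⟨by decide, by decide, by decide, by decide, by decide, by decide⟩

/-- The three snakes of type `B₂`: `(2,1), (2,−1), (1,−2)`. [cite: Hoffman1999DerivativePolynomials, §4 Definition (snakes of type Bₙ)] -/
theorem snakesB_two :
    (((List.range' 1 2).permutations'.flatMap signings).filter fun x => zigzagWord true (0 :: x)) ~
      [[2, 1], [2, -1], [1, -2]] := by
  decide

/-! ### §2 The sign pattern decomposition and `card βₙ(S) = 2^{|S|} E_{|S|}` -/

/-- The set of letters obtained from the absolute values `S` by making the letters in `N` negative.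
[cite: Hoffman1999DerivativePolynomials, §4 remark after Theorem 4.3 («card βₙ = 2ⁿa_{n−1}, which has a simple combinatorial interpretation in terms of snakes (cf. Theorem 24 of [3])»)] -/
def signedSet (S N : Finset ℕ) : Finset ℤ := S.image fun a => if a ∈ N then -(a : ℤ) else (a : ℤ)

/-- The absolute value undoes the signing. [cite: Hoffman1999DerivativePolynomials, §4 («{|x₁|, …, |xₙ|} = {1, …, n}»)] -/
theorem natAbs_signLetter (N : Finset ℕ) (a : ℕ) :
    Int.natAbs (if a ∈ N then -(a : ℤ) else (a : ℤ)) = a := by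
  split_ifs <;> simp

/-- `|signedSet S N| = |S|`. [cite: Hoffman1999DerivativePolynomials, §4 remark after Theorem 4.3 («2ⁿa_{n−1}»)] -/
theorem card_signedSet (S N : Finset ℕ) : (signedSet S N).card = S.card :=
  Finset.card_image_of_injOn fun a _ b _ h => by
    have := congrArg Int.natAbs h
    rwa [natAbs_signLetter, natAbs_signLetter] at this

/-- The image of `signedSet S N` under the absolute value is `S`. [cite: Hoffman1999DerivativePolynomials, §4 («{|x₁|, …, |xₙ|} = {1, …, n}»)] -/
theorem image_natAbs_signedSet (S N : Finset ℕ) : (signedSet S N).image Int.natAbs = S := by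
  rw [signedSet, Finset.image_image]
  conv_rhs => rw [← Finset.image_id (s := S)]
  exact Finset.image_congr fun a _ => natAbs_signLetter N a

/-- `{|x₁|, …, |xₙ|}` as the image of the letter set under the absolute value.
[cite: Hoffman1999DerivativePolynomials, §4 («{|x₁|, …, |xₙ|} = {1, …, n}»)] -/
theorem toFinset_map_eq_image (x : List ℤ) : (x.map Int.natAbs).toFinset = x.toFinset.image Int.natAbs := by
  ext a
  simp [Finset.mem_image]

/-- **Decomposition by sign pattern**: a signed arrangement of `S` is an (ordinary) arrangement of exactly one
of the `2^{|S|}` letter sets `signedSet S N`, `N ⊆ S`.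
[cite: Hoffman1999DerivativePolynomials, §4 remark after Theorem 4.3 («card βₙ = 2ⁿa_{n−1} … simple combinatorial interpretation in terms of snakes»)] -/
theorem signedArrangements_eq_biUnion (S : Finset ℕ) :
    signedArrangements S = S.powerset.biUnion fun N => arrangements (signedSet S N) := by
  ext x
  rw [mem_signedArrangements, Finset.mem_biUnion]
  constructor
  · rintro ⟨hnd, hS⟩
    have hinj : ∀ c ∈ x, ∀ c' ∈ x, Int.natAbs c = Int.natAbs c' → c = c' := inj_on_of_nodup_map hnd
    refine ⟨S.filter fun a => -(a : ℤ) ∈ x, Finset.mem_powerset.2 (Finset.filter_subset _ _),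
      mem_arrangements.2 ⟨hnd.of_map _, ?_⟩⟩
    ext c
    rw [mem_toFinset, signedSet, Finset.mem_image]
    constructor
    · intro hc
      have hcS : Int.natAbs c ∈ S := by
        rw [← hS, mem_toFinset]; exact mem_map.2 ⟨c, hc, rfl⟩
      refine ⟨Int.natAbs c, hcS, ?_⟩
      split_ifs with hmem
      · exact hinj _ (Finset.mem_filter.1 hmem).2 _ hc (by rw [Int.natAbs_neg, Int.natAbs_natCast])
      · rcases Int.natAbs_eq c with h | h
        · exact h.symm
        · exfalso; apply hmem; rw [Finset.mem_filter]; refine ⟨hcS, ?_⟩; rw [← h]; exact hc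
    · rintro ⟨a, haS, rfl⟩
      have hax : ∃ c ∈ x, Int.natAbs c = a := by
        rw [← hS, mem_toFinset, mem_map] at haS; exact haS
      obtain ⟨c, hc, hca⟩ := hax
      split_ifs with hmem
      · exact (Finset.mem_filter.1 hmem).2
      · rcases Int.natAbs_eq c with h | h <;> rw [hca] at h
        · rw [← h]; exact hc
        · exfalso; apply hmem; rw [Finset.mem_filter]; refine ⟨haS, ?_⟩; rw [← h]; exact hc
  · rintro ⟨N, -, hx⟩
    obtain ⟨hnd, hxN⟩ := mem_arrangements.1 hx
    have hinj : ∀ c ∈ x, ∀ c' ∈ x, Int.natAbs c = Int.natAbs c' → c = c' := by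
      intro c hc c' hc' h
      have hc2 := hxN ▸ mem_toFinset.2 hc
      have hc'2 := hxN ▸ mem_toFinset.2 hc'
      rw [signedSet, Finset.mem_image] at hc2 hc'2
      obtain ⟨a, -, rfl⟩ := hc2
      obtain ⟨a', -, rfl⟩ := hc'2
      rw [natAbs_signLetter, natAbs_signLetter] at h
      rw [h]
    refine ⟨hnd.map_on hinj, ?_⟩
    rw [toFinset_map_eq_image, hxN, image_natAbs_signedSet]

/-- The sign pattern is recovered from the letter set: for `0 ∉ S` and `N ⊆ S`, `a ∈ N` iff `−a` is a letter.
[cite: Hoffman1999DerivativePolynomials, §4 remark after Theorem 4.3 («2ⁿa_{n−1}»)] -/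
theorem mem_iff_neg_mem_signedSet {S N : Finset ℕ} (hS : (0 : ℕ) ∉ S) (hN : N ⊆ S) (a : ℕ) :
    a ∈ N ↔ a ∈ S ∧ -(a : ℤ) ∈ signedSet S N := by
  constructor
  · intro ha
    refine ⟨hN ha, Finset.mem_image.2 ⟨a, hN ha, by rw [if_pos ha]⟩⟩
  · rintro ⟨haS, hneg⟩
    obtain ⟨b, hbS, hb⟩ := Finset.mem_image.1 hneg
    have hba : b = a := by
      have := congrArg Int.natAbs hb
      rwa [natAbs_signLetter, Int.natAbs_neg, Int.natAbs_natCast] at this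
    subst hba
    by_contra hbN
    rw [if_neg hbN] at hb
    have : (b : ℤ) = 0 := by omega
    have hb0 : b = 0 := by exact_mod_cast this
    exact hS (hb0 ▸ hbS)

/-- Different sign patterns give different letter sets (`0 ∉ S`). [cite: Hoffman1999DerivativePolynomials, §4 remark after Theorem 4.3 («2ⁿa_{n−1}»)] -/
theorem signedSet_injOn {S : Finset ℕ} (hS : (0 : ℕ) ∉ S) {N N' : Finset ℕ} (hN : N ⊆ S) (hN' : N' ⊆ S)
    (h : signedSet S N = signedSet S N') : N = N' := by
  ext a
  rw [mem_iff_neg_mem_signedSet hS hN, mem_iff_neg_mem_signedSet hS hN', h]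

/-- ★★ **`card βₙ = 2ⁿ a_{n−1}`, combinatorially** (Arnol'd's Theorem 24, Hoffman's remark): the signed arrangements
of `S` (`0 ∉ S`) that zigzag in a given sense number `2^{|S|}·E_{|S|}` — choose the sign pattern (`2^{|S|}` ways),
then a (reverse) alternating arrangement of the resulting `|S|` distinct integers (`E_{|S|}` ways, the tree's
`card_filter_arrangements_zigzagWord`).
[cite: Hoffman1999DerivativePolynomials, §4 remark after Theorem 4.3 («equation (5) above implies card βₙ = 2ⁿa_{n−1}, which has a simple combinatorial interpretation in terms of snakes (cf. Theorem 24 of [3])»); Arnold1992Snakes, Theorem 24] -/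
theorem card_filter_signedArrangements_zigzagWord {S : Finset ℕ} (hS : (0 : ℕ) ∉ S) (up : Bool) :
    ((signedArrangements S).filter fun x => zigzagWord up x = true).card = 2 ^ S.card * eulerZigzag S.card := by
  rw [signedArrangements_eq_biUnion, Finset.filter_biUnion, Finset.card_biUnion]
  · rw [Finset.sum_congr rfl fun N _ => by rw [card_filter_arrangements_zigzagWord, card_signedSet],
      Finset.sum_const, Finset.card_powerset, smul_eq_mul]
  · intro N hN N' hN' hne
    rw [Function.onFun, Finset.disjoint_left]
    intro x hx hx'
    rw [Finset.mem_filter, mem_arrangements] at hx hx'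
    exact hne (signedSet_injOn hS (Finset.mem_powerset.1 hN) (Finset.mem_powerset.1 hN')
      (hx.1.2.symm.trans hx'.1.2))

/-- ★★ **The number of snakes of type `β` on `S`** (`0 ∉ S`): `card β(S) = 2^{|S|} E_{|S|}`.
[cite: Hoffman1999DerivativePolynomials, §4 remark after Theorem 4.3 («card βₙ = 2ⁿa_{n−1}»); Arnold1992Snakes, Theorem 24] -/
theorem card_betaSnakes {S : Finset ℕ} (hS : (0 : ℕ) ∉ S) :
    (betaSnakes S).card = 2 ^ S.card * eulerZigzag S.card :=
  card_filter_signedArrangements_zigzagWord hS true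

/-- ★★★ **Theorem 4.2 (type `β`)**: `card βₙ = Pₙ(1)` — here from `card βₙ = 2ⁿEₙ` and equation (5)
`Pₙ(1) = 2ⁿEₙ` (`DerivativePolynomials.eval_one_P`); Hoffman's own route is the recurrence
`card β_{n+1} = Σ binom(n,r) card β_r card β_{n−r} + δ_{n0}`, which we recover below (`card_betaSnakes_succ`).
[cite: Hoffman1999DerivativePolynomials, §4 Theorem 4.2 («β(t) = P(1,t) (so … card βₙ = Pₙ(1))»)] -/
theorem card_betaSnakes_eq_eval_one_P {S : Finset ℕ} (hS : (0 : ℕ) ∉ S) :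
    (betaSnakes S).card = (TangentNumbers.P S.card).eval 1 := by
  rw [card_betaSnakes hS, DerivativePolynomials.eval_one_P]

/-- Theorem 4.2 (type `β`) on the absolute values `{1, …, n}`: `card βₙ = Pₙ(1) = 2ⁿEₙ`.
[cite: Hoffman1999DerivativePolynomials, §4 Theorem 4.2 («card βₙ = Pₙ(1)»)] -/
theorem card_betaSnakes_Icc (n : ℕ) :
    (betaSnakes (Finset.Icc 1 n)).card = (TangentNumbers.P n).eval 1 := by
  rw [card_betaSnakes_eq_eval_one_P (by simp), Nat.card_Icc, Nat.add_sub_cancel]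

/-- Hoffman's recurrence for the `β`-snakes, `card β_{n+1} = Σ_r binom(n,r) card β_r card β_{n−r} + δ_{n0}`
(«The Kronecker delta term reflects the fact that there are two β₁-snakes, (1) and (−1)»).
[cite: Hoffman1999DerivativePolynomials, §4 proof of Theorem 4.2 («card β_{n+1} = Σ_{r=0}^{n} binom(n,r) card β_r card β_{n−r} + δ_{n0}»)] -/
theorem card_betaSnakes_succ (n : ℕ) :
    (betaSnakes (Finset.Icc 1 (n + 1))).card = (if n = 0 then 1 else 0) +
      ∑ r ∈ Finset.range (n + 1), n.choose r * (betaSnakes (Finset.Icc 1 r)).card *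
        (betaSnakes (Finset.Icc 1 (n - r))).card := by
  simp only [card_betaSnakes_Icc]
  exact DerivativePolynomials.eval_one_P_succ n

/-! ### §3 Cutting a reverse alternating word at its least or at its greatest letter -/

section Cut

variable {α : Type*} [LinearOrder α]

/-- **Cut at the minimum, reverse alternating case.**  If `m` lies below every letter of `u` and `v`, then
`u m v` is reverse alternating (`u₁ < u₂ > ⋯`) iff `|u|` is even, `u` is reverse alternating and `v` is
alternating (the least letter sits at a valley).
[cite: Hoffman1999DerivativePolynomials, §4 proof of Theorem 4.2 («let r be the unique element of {0, …, n} with |x_{r+1}| = n + 1 … (x₁, …, x_r) can be shrunk into a snake of type β_r … ((−1)^{r+1}x_{r+2}, …, (−1)^{r+1}x_{n+1}) gives a snake of type β_{n−r}»)] -/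
theorem zigzagWord_true_append_cons_iff_of_forall_gt {m : α} {u v : List α} (hu : ∀ a ∈ u, m < a)
    (hv : ∀ b ∈ v, m < b) :
    zigzagWord true (u ++ m :: v) = true ↔
      Even u.length ∧ zigzagWord true u = true ∧ zigzagWord false v = true := by
  cases u with
  | nil => simp [zigzagWord_true_cons_of_forall_lt hv]
  | cons a u =>
      have hl : m < (a :: u).getLast (cons_ne_nil a u) := hu _ (getLast_mem _)
      rw [zigzagWord_cons_append, Bool.and_eq_true, length_cons]
      by_cases h : Even u.length
      · have hne : ¬ Even (u.length + 1) := fun h' => (Nat.even_add_one.1 h') h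
        simp [h, hne, not_lt.2 hl.le]
      · have he : Even (u.length + 1) := Nat.even_add_one.2 h
        simp [h, he, hl, zigzagWord_true_cons_of_forall_lt hv]

end Cut

/-- Negating every letter exchanges alternating and reverse alternating words.
[cite: Hoffman1999DerivativePolynomials, §4 proof of Theorem 4.3 («f(x₁, …, xₙ) = (−x₁, …, −xₙ): it is easy to see that f is a bijection of βₙ⁻ onto Bₙ»)] -/
theorem zigzagWord_map_neg (up : Bool) (w : List ℤ) :
    zigzagWord up (w.map Neg.neg) = zigzagWord (!up) w :=
  zigzagWord_map_of_strictAntiOn (s := Set.univ) (fun _ _ _ _ h => neg_lt_neg h) up w fun _ _ => trivial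

/-- **Cut at the maximum, reverse alternating case.**  If `M` lies above every letter of `u` and `v` (not both
empty), then `u M v` is reverse alternating iff `|u|` is odd and both `u` and `v` are reverse alternating
(the greatest letter sits at a peak).  By negation from the tree's `zigzagWord_append_cons_iff`.
[cite: Hoffman1999DerivativePolynomials, §4 proof of Theorem 4.2 («let r be the unique element of {0, …, n} with |x_{r+1}| = n + 1 …»)] -/
theorem zigzagWord_true_append_cons_iff_of_forall_lt {M : ℤ} {u v : List ℤ} (hu : ∀ a ∈ u, a < M)
    (hv : ∀ b ∈ v, b < M) (hne : u ≠ [] ∨ v ≠ []) :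
    zigzagWord true (u ++ M :: v) = true ↔
      Odd u.length ∧ zigzagWord true u = true ∧ zigzagWord true v = true := by
  have key := zigzagWord_append_cons_iff (m := -M) (u := u.map Neg.neg) (v := v.map Neg.neg)
    (fun a ha => by obtain ⟨b, hb, rfl⟩ := mem_map.1 ha; exact neg_lt_neg (hu b hb))
    (fun a ha => by obtain ⟨b, hb, rfl⟩ := mem_map.1 ha; exact neg_lt_neg (hv b hb))
    (by simpa using hne)
  rw [length_map, zigzagWord_map_neg, zigzagWord_map_neg, show (!false) = true from rfl] at key
  rw [← key, show map Neg.neg u ++ -M :: map Neg.neg v = (u ++ M :: v).map Neg.neg by simp,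
    zigzagWord_map_neg, show (!false) = true from rfl]

/-! ### §4 Theorem 4.2 for the snakes of type `B`: the cut at the letter of greatest absolute value -/

section Recurrence

/-- The sign the letter `±M` must carry after a left piece of length `r`: `+M` at a peak (`r` even),
`−M` at a valley (`r` odd). [cite: Hoffman1999DerivativePolynomials, §4 proof of Theorem 4.2 («with r ∈ {0, …, n} such that |x_{r+1}| = n + 1»)] -/
def signedMax (M r : ℕ) : ℤ := if Even r then (M : ℤ) else -(M : ℤ)

/-- Hoffman's sign normalisation `((−1)^r x_{r+2}, …, (−1)^r x_{n+1})` of the right piece.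
[cite: Hoffman1999DerivativePolynomials, §4 proof of Theorem 4.2 («the shrinkage of the sequence ((−1)^r x_{r+2}, …, (−1)^r x_{n+1}) is a snake of type β_{n−r}»)] -/
def negIfOdd (r : ℕ) (v : List ℤ) : List ℤ := if Even r then v else v.map Neg.neg

/-- The sign normalisation is an involution. [cite: Hoffman1999DerivativePolynomials, §4 proof of Theorem 4.2 («Conversely … we can construct a … snake in a unique way»)] -/
theorem negIfOdd_negIfOdd (r : ℕ) (v : List ℤ) : negIfOdd r (negIfOdd r v) = v := by
  unfold negIfOdd
  split_ifs
  · rfl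
  · simp [map_map]

/-- The sign normalisation does not change absolute values. [cite: Hoffman1999DerivativePolynomials, §4 proof of Theorem 4.2 («integers whose absolute values partition {1, …, n}»)] -/
theorem map_natAbs_negIfOdd (r : ℕ) (v : List ℤ) : (negIfOdd r v).map Int.natAbs = v.map Int.natAbs := by
  unfold negIfOdd
  split_ifs
  · rfl
  · simp [map_map, Function.comp_def]

/-- `|negIfOdd r v| = |v|`. [cite: Hoffman1999DerivativePolynomials, §4 proof of Theorem 4.2] -/
theorem length_negIfOdd (r : ℕ) (v : List ℤ) : (negIfOdd r v).length = v.length := by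
  rw [← length_map (f := Int.natAbs), map_natAbs_negIfOdd, length_map]

/-- `|±M| = M`. [cite: Hoffman1999DerivativePolynomials, §4 proof of Theorem 4.2 («|x_{r+1}| = n + 1»)] -/
theorem natAbs_signedMax (M r : ℕ) : (signedMax M r).natAbs = M := by
  unfold signedMax; split_ifs <;> simp

/-- The left piece: the longest prefix avoiding the absolute value `M`. [cite: Hoffman1999DerivativePolynomials, §4 proof of Theorem 4.2 («(x₁, …, x_r)»)] -/
def leftPiece (M : ℕ) (x : List ℤ) : List ℤ := x.takeWhile fun a => decide (a.natAbs ≠ M)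

/-- The right piece: what follows the letter of absolute value `M`. [cite: Hoffman1999DerivativePolynomials, §4 proof of Theorem 4.2 («(x_{r+2}, …, x_{n+1})»)] -/
def rightPiece (M : ℕ) (x : List ℤ) : List ℤ := (x.dropWhile fun a => decide (a.natAbs ≠ M)).tail

/-- `leftPiece` of `u c v` is `u` when `u` avoids `M = |c|`. [cite: Hoffman1999DerivativePolynomials, §4 proof of Theorem 4.2] -/
theorem leftPiece_append_cons {M : ℕ} {u : List ℤ} {c : ℤ} (v : List ℤ) (hu : ∀ a ∈ u, a.natAbs ≠ M)
    (hc : c.natAbs = M) : leftPiece M (u ++ c :: v) = u := by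
  rw [leftPiece, takeWhile_append_of_pos (fun a ha => by simpa using hu a ha),
    takeWhile_cons_of_neg (by simp [hc]), append_nil]

/-- `rightPiece` of `u c v` is `v` when `u` avoids `M = |c|`. [cite: Hoffman1999DerivativePolynomials, §4 proof of Theorem 4.2] -/
theorem rightPiece_append_cons {M : ℕ} {u : List ℤ} {c : ℤ} (v : List ℤ) (hu : ∀ a ∈ u, a.natAbs ≠ M)
    (hc : c.natAbs = M) : rightPiece M (u ++ c :: v) = v := by
  rw [rightPiece, dropWhile_append_of_pos (fun a ha => by simpa using hu a ha),
    dropWhile_cons_of_neg (by simp [hc]), tail_cons]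

/-- A signed word using the absolute value `M` once splits as `u c v` with `|c| = M` and `u` avoiding `M`.
[cite: Hoffman1999DerivativePolynomials, §4 proof of Theorem 4.2 («let r be the unique element of {0, …, n} with |x_{r+1}| = n + 1»)] -/
theorem exists_split {M : ℕ} {x : List ℤ} (hnd : (x.map Int.natAbs).Nodup) (hM : M ∈ (x.map Int.natAbs).toFinset) :
    ∃ u c v, x = u ++ c :: v ∧ c.natAbs = M ∧ (∀ a ∈ u, a.natAbs ≠ M) ∧ ∀ b ∈ v, b.natAbs ≠ M := by
  rw [mem_toFinset, mem_map] at hM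
  obtain ⟨c, hc, hcM⟩ := hM
  obtain ⟨u, v, rfl⟩ := append_of_mem hc
  rw [map_append, map_cons, nodup_append, nodup_cons] at hnd
  obtain ⟨-, ⟨hcv, -⟩, huv⟩ := hnd
  refine ⟨u, c, v, rfl, hcM, fun a ha haM => ?_, fun b hb hbM => hcv ?_⟩
  · exact huv _ (mem_map.2 ⟨a, ha, rfl⟩) _ (mem_cons_self) (haM.trans hcM.symm)
  · exact mem_map.2 ⟨b, hb, hbM.trans hcM.symm⟩

/-- ★★★ **Theorem 4.2 for type `B`, the bijection** («Now suppose (x₁, …, x_{n+1}) ∈ B_{n+1}, with r such that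
|x_{r+1}| = n + 1. … (x₁, …, x_r) can be shrunk into a B_r-snake, since x₁ > 0; but the shrinkage of the sequence
((−1)^r x_{r+2}, …, (−1)^r x_{n+1}) is a snake of type β_{n−r}. Hence card B_{n+1} = Σ_r binom(n,r) card B_r
card β_{n−r}»).  Typed for an arbitrary finite set `S ∌ 0` of absolute values with greatest element `M`: the
snakes of type `B` on `S` correspond to the pairs (snake of type `B` on `T`, snake of type `β` on
`S ∖ {M} ∖ T`), `T ⊆ S ∖ {M}`; no shrinking is needed since our snakes live on arbitrary sets of absolute values.
(The printed sign `(−1)^r`, with `r` the number of letters before `±(n+1)`, is `(−1)^{r}` for `B` because of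
the leading `0 <`: `+M` occurs at the peaks, after an even number of letters of `x`.)
[cite: Hoffman1999DerivativePolynomials, §4 proof of Theorem 4.2 («Hence card B_{n+1} = Σ_{r=0}^{n} binom(n,r) card B_r card β_{n−r}»)] -/
theorem card_bSnakes_eq_sum {S : Finset ℕ} {M : ℕ} (hS : (0 : ℕ) ∉ S) (hM : M ∈ S)
    (hmax : ∀ a ∈ S, a ≤ M) :
    (bSnakes S).card =
      ∑ T ∈ (S.erase M).powerset, (bSnakes T).card * (betaSnakes (S.erase M \ T)).card := by
  classical
  have hM0 : 0 < M := Nat.pos_of_ne_zero fun h => hS (h ▸ hM)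
  set S' : Finset ℕ := S.erase M with hS'
  have hS'mem : ∀ a, a ∈ S' ↔ a ≠ M ∧ a ∈ S := fun a => by rw [hS', Finset.mem_erase]
  -- the right-hand side as a set of pairs
  set F : Finset ℕ → Finset (List ℤ × List ℤ) := fun T => bSnakes T ×ˢ betaSnakes (S' \ T) with hF
  have hFmem : ∀ T u v, (u, v) ∈ F T ↔
      ((u.map Int.natAbs).Nodup ∧ (u.map Int.natAbs).toFinset = T ∧ zigzagWord true (0 :: u) = true) ∧
        ((v.map Int.natAbs).Nodup ∧ (v.map Int.natAbs).toFinset = S' \ T ∧ zigzagWord true v = true) := by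
    intro T u v
    simp only [hF, Finset.mem_product, bSnakes, betaSnakes, Finset.mem_filter, mem_signedArrangements,
      and_assoc]
  have hdisj : ((S'.powerset : Finset (Finset ℕ)) : Set (Finset ℕ)).PairwiseDisjoint F := by
    intro T _ T' _ hne
    rw [Function.onFun, Finset.disjoint_left]
    rintro ⟨u, v⟩ h h'
    rw [hFmem] at h h'
    exact hne (h.1.2.1.symm.trans h'.1.2.1)
  rw [← Finset.sum_congr rfl fun T _ => (Finset.card_product (bSnakes T) (betaSnakes (S' \ T))),
    ← Finset.card_biUnion hdisj]
  have hBmem : ∀ u v, (u, v) ∈ S'.powerset.biUnion F ↔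
      (u.map Int.natAbs).Nodup ∧ (u.map Int.natAbs).toFinset ⊆ S' ∧ zigzagWord true (0 :: u) = true ∧
        (v.map Int.natAbs).Nodup ∧ (v.map Int.natAbs).toFinset = S' \ (u.map Int.natAbs).toFinset ∧
          zigzagWord true v = true := by
    intro u v
    rw [Finset.mem_biUnion]
    constructor
    · rintro ⟨T, hT, huv⟩
      rw [hFmem] at huv
      obtain ⟨⟨hund, huT, huz⟩, hvnd, hvT, hvz⟩ := huv
      exact ⟨hund, huT ▸ Finset.mem_powerset.1 hT, huz, hvnd, huT ▸ hvT, hvz⟩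
    · rintro ⟨hund, huT, huz, hvnd, hvT, hvz⟩
      exact ⟨_, Finset.mem_powerset.2 huT, (hFmem _ u v).2 ⟨⟨hund, rfl, huz⟩, hvnd, hvT, hvz⟩⟩
  have hAmem : ∀ x, x ∈ bSnakes S ↔
      (x.map Int.natAbs).Nodup ∧ (x.map Int.natAbs).toFinset = S ∧ zigzagWord true (0 :: x) = true := by
    intro x; rw [bSnakes, Finset.mem_filter, mem_signedArrangements, and_assoc]
  -- analysis of a snake of type B on S
  have hsplit : ∀ x, x ∈ bSnakes S →
      ∃ u v, x = u ++ signedMax M u.length :: negIfOdd u.length v ∧ (u, v) ∈ S'.powerset.biUnion F ∧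
        ∀ a ∈ u, a.natAbs ≠ M := by
    intro x hx
    obtain ⟨hnd, hxS, hz⟩ := (hAmem x).1 hx
    obtain ⟨u, c, v, rfl, hcM, huM, hvM⟩ := exists_split hnd (hxS.symm ▸ hM)
    have hnd' := hnd
    rw [map_append, map_cons, nodup_append, nodup_cons] at hnd'
    obtain ⟨hund, ⟨hcv, hvnd⟩, huv⟩ := hnd'
    have hmemS : ∀ a ∈ u ++ c :: v, a.natAbs ∈ S := fun a ha => by
      rw [← hxS, mem_toFinset]; exact mem_map.2 ⟨a, ha, rfl⟩
    have hult : ∀ a ∈ u, a.natAbs < M := fun a ha =>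
      lt_of_le_of_ne (hmax _ (hmemS a (mem_append_left _ ha))) (huM a ha)
    have hvlt : ∀ b ∈ v, b.natAbs < M := fun b hb =>
      lt_of_le_of_ne (hmax _ (hmemS b (mem_append_right _ (mem_cons_of_mem _ hb)))) (hvM b hb)
    have huT : (u.map Int.natAbs).toFinset ⊆ S' := by
      intro a ha
      rw [mem_toFinset, mem_map] at ha
      obtain ⟨b, hb, rfl⟩ := ha
      exact (hS'mem _).2 ⟨huM b hb, hmemS b (mem_append_left _ hb)⟩
    have hvT : (v.map Int.natAbs).toFinset = S' \ (u.map Int.natAbs).toFinset := by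
      ext a
      rw [Finset.mem_sdiff, hS'mem, mem_toFinset, mem_toFinset, mem_map, mem_map]
      constructor
      · rintro ⟨b, hb, rfl⟩
        exact ⟨⟨hvM b hb, hmemS b (mem_append_right _ (mem_cons_of_mem _ hb))⟩,
          fun ⟨a', ha', he⟩ => huv _ (mem_map.2 ⟨a', ha', rfl⟩) _ (mem_cons_of_mem _
            (mem_map.2 ⟨b, hb, rfl⟩)) he⟩
      · rintro ⟨⟨haM, haS⟩, hau⟩
        have : a ∈ (map Int.natAbs (u ++ c :: v)).toFinset := by rw [hxS]; exact haS
        rw [mem_toFinset, map_append, map_cons, mem_append, mem_cons, mem_map] at this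
        rcases this with h | h | h
        · exact absurd h hau
        · exact absurd (h.trans hcM) haM
        · exact mem_map.1 h
    -- the sign of `c` against the parity of `|u|`
    have h0u : ∀ a ∈ (0 :: u : List ℤ), -(M : ℤ) < a ∧ a < M := fun a ha => by
      rcases mem_cons.1 ha with h | h
      · subst h; constructor <;> omega
      · have := hult a h; constructor <;> omega
    rw [← cons_append] at hz
    rcases Int.natAbs_eq c with hc | hc <;> rw [hcM] at hc <;> rw [hc] at hz
    · -- `c = +M` sits at a peak: `|0 u|` is odd, `|u|` is even, the right piece is already a `β`-snake
      obtain ⟨hodd, huz, hvz⟩ := (zigzagWord_true_append_cons_iff_of_forall_lt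
        (fun a ha => (h0u a ha).2) (fun b hb => by have := hvlt b hb; omega) (Or.inl (cons_ne_nil _ _))).1 hz
      have heven : Even u.length :=
        Nat.not_odd_iff_even.1 (Nat.odd_add_one.1 (by simpa using hodd))
      refine ⟨u, v, ?_, ?_, huM⟩
      · rw [hc, signedMax, if_pos heven, negIfOdd, if_pos heven]
      · rw [hBmem]
        exact ⟨hund, huT, huz, hvnd, hvT, hvz⟩
    · -- `c = −M` sits at a valley: `|0 u|` is even, `|u|` is odd, the right piece is negated
      obtain ⟨hev, huz, hvz⟩ := (zigzagWord_true_append_cons_iff_of_forall_gt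
        (fun a ha => (h0u a ha).1) (fun b hb => by have := hvlt b hb; omega)).1 hz
      have hodd : ¬ Even u.length := by
        rw [length_cons] at hev; exact Nat.even_add_one.1 hev
      refine ⟨u, v.map Neg.neg, ?_, ?_, huM⟩
      · rw [hc, signedMax, if_neg hodd, negIfOdd, if_neg hodd, map_map]
        simp
      · rw [hBmem, show (v.map Neg.neg).map Int.natAbs = v.map Int.natAbs by simp [map_map, Function.comp_def],
          zigzagWord_map_neg, show (!true) = false from rfl]
        exact ⟨hund, huT, huz, hvnd, hvT, hvz⟩
  -- synthesis of a snake of type B on S from a pair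
  have hglue : ∀ u v, (u, v) ∈ S'.powerset.biUnion F →
      u ++ signedMax M u.length :: negIfOdd u.length v ∈ bSnakes S ∧ ∀ a ∈ u, a.natAbs ≠ M := by
    intro u v huv
    obtain ⟨hund, huT, huz, hvnd, hvT, hvz⟩ := (hBmem u v).1 huv
    have huS' : ∀ a ∈ u, a.natAbs ∈ S' := fun a ha => huT (mem_toFinset.2 (mem_map.2 ⟨a, ha, rfl⟩))
    have hvS' : ∀ b ∈ v, b.natAbs ∈ S' ∧ b.natAbs ∉ (u.map Int.natAbs).toFinset := fun b hb => by
      have := hvT ▸ mem_toFinset.2 (mem_map.2 ⟨b, hb, rfl⟩)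
      rwa [Finset.mem_sdiff] at this
    have huM : ∀ a ∈ u, a.natAbs ≠ M := fun a ha => ((hS'mem _).1 (huS' a ha)).1
    have hvM : ∀ b ∈ v, b.natAbs ≠ M := fun b hb => ((hS'mem _).1 (hvS' b hb).1).1
    have hult : ∀ a ∈ u, a.natAbs < M := fun a ha =>
      lt_of_le_of_ne (hmax _ ((hS'mem _).1 (huS' a ha)).2) (huM a ha)
    have hvlt : ∀ b ∈ v, b.natAbs < M := fun b hb =>
      lt_of_le_of_ne (hmax _ ((hS'mem _).1 (hvS' b hb).1).2) (hvM b hb)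
    have h0u : ∀ a ∈ (0 :: u : List ℤ), -(M : ℤ) < a ∧ a < M := fun a ha => by
      rcases mem_cons.1 ha with h | h
      · subst h; constructor <;> omega
      · have := hult a h; constructor <;> omega
    refine ⟨(hAmem _).2 ⟨?_, ?_, ?_⟩, huM⟩
    · rw [map_append, map_cons, natAbs_signedMax, map_natAbs_negIfOdd, nodup_append]
      refine ⟨hund, nodup_cons.2 ⟨fun h => ?_, hvnd⟩, fun a ha b hb hab => ?_⟩
      · obtain ⟨b, hb, hbM⟩ := mem_map.1 h
        exact hvM b hb hbM
      · obtain ⟨a', ha', rfl⟩ := mem_map.1 ha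
        rcases mem_cons.1 hb with h | h
        · exact huM a' ha' (hab.trans h)
        · obtain ⟨b', hb', rfl⟩ := mem_map.1 h
          exact (hvS' b' hb').2 (hab ▸ mem_toFinset.2 (mem_map.2 ⟨a', ha', rfl⟩))
    · rw [map_append, map_cons, natAbs_signedMax, map_natAbs_negIfOdd]
      ext a
      rw [mem_toFinset, mem_append, mem_cons]
      constructor
      · rintro (h | h | h)
        · exact ((hS'mem _).1 (huT (mem_toFinset.2 h))).2
        · exact h ▸ hM
        · obtain ⟨b, hb, rfl⟩ := mem_map.1 h
          exact ((hS'mem _).1 (hvS' b hb).1).2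
      · intro haS
        by_cases haM : a = M
        · exact Or.inr (Or.inl haM)
        · by_cases hau : a ∈ (u.map Int.natAbs).toFinset
          · exact Or.inl (mem_toFinset.1 hau)
          · have : a ∈ (v.map Int.natAbs).toFinset := by
              rw [hvT, Finset.mem_sdiff, hS'mem]; exact ⟨⟨haM, haS⟩, hau⟩
            exact Or.inr (Or.inr (mem_toFinset.1 this))
    · rw [← cons_append]
      by_cases he : Even u.length
      · rw [signedMax, if_pos he, negIfOdd, if_pos he]
        exact (zigzagWord_true_append_cons_iff_of_forall_lt (fun a ha => (h0u a ha).2)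
          (fun b hb => by have := hvlt b hb; omega) (Or.inl (cons_ne_nil _ _))).2
          ⟨by rw [length_cons]; exact Nat.odd_add_one.2 (Nat.not_odd_iff_even.2 he), huz, hvz⟩
      · rw [signedMax, if_neg he, negIfOdd, if_neg he]
        exact (zigzagWord_true_append_cons_iff_of_forall_gt (fun a ha => (h0u a ha).1)
          (fun b hb => by
            obtain ⟨b', hb', rfl⟩ := mem_map.1 hb
            have := hvlt b' hb'; omega)).2
          ⟨by rw [length_cons]; exact Nat.even_add_one.2 he, huz,
            by rw [zigzagWord_map_neg, show (!false) = true from rfl]; exact hvz⟩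
  -- the bijection `x = u (±M) v ↦ (u, ±v)`
  refine Finset.card_bij'
    (fun x _ => (leftPiece M x, negIfOdd (leftPiece M x).length (rightPiece M x)))
    (fun q _ => q.1 ++ signedMax M q.1.length :: negIfOdd q.1.length q.2) ?_ ?_ ?_ ?_
  · intro x hx
    obtain ⟨u, v, hxeq, huv, huM⟩ := hsplit x hx
    show (_, _) ∈ _
    rw [hxeq, leftPiece_append_cons _ huM (natAbs_signedMax M _),
      rightPiece_append_cons _ huM (natAbs_signedMax M _), negIfOdd_negIfOdd]
    exact huv
  · rintro ⟨u, v⟩ hq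
    exact (hglue u v hq).1
  · intro x hx
    obtain ⟨u, v, hxeq, huv, huM⟩ := hsplit x hx
    show _ ++ _ :: _ = x
    rw [hxeq, leftPiece_append_cons _ huM (natAbs_signedMax M _),
      rightPiece_append_cons _ huM (natAbs_signedMax M _), negIfOdd_negIfOdd]
  · rintro ⟨u, v⟩ hq
    obtain ⟨-, huM⟩ := hglue u v hq
    show (_, _) = (u, v)
    rw [leftPiece_append_cons _ huM (natAbs_signedMax M _),
      rightPiece_append_cons _ huM (natAbs_signedMax M _), negIfOdd_negIfOdd]

end Recurrence

/-! ### §5 Theorem 4.2: `card Bₙ = Qₙ(1)` and the generating functions `b(t) = Q(1,t)`, `β(t) = P(1,t)` -/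

/-- `B(∅) = {()}`: the empty snake. [cite: Hoffman1999DerivativePolynomials, §4 proof of Theorem 4.2 («β₀ consists of the empty snake», «b(0) = 1»)] -/
theorem bSnakes_empty : bSnakes ∅ = {[]} := by
  ext x
  rw [bSnakes, Finset.mem_filter, mem_signedArrangements, Finset.mem_singleton]
  constructor
  · rintro ⟨⟨-, h⟩, -⟩
    have : x.map Int.natAbs = [] := (toFinset_eq_empty_iff _).1 h
    exact map_eq_nil_iff.1 this
  · rintro rfl
    simp

/-- ★★★ **Theorem 4.2 (type `B`)**: the snakes of type `B` on any `n`-set `S ∌ 0` of absolute values number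
`Qₙ(1)` — by strong induction on `n` from the cut recurrence (`card_bSnakes_eq_sum`), `card β = 2^{k}E_k`
and the recurrence `Q_{n+1}(1) = Σ binom(n,k) Q_k(1)·2^{n−k}E_{n−k}` («b′(t) = b(t)β(t) … b(t) = Q(1,t)»).
[cite: Hoffman1999DerivativePolynomials, §4 Theorem 4.2 («b(t) = Q(1,t) … (so card Bₙ = Qₙ(1) …)»)] -/
theorem card_bSnakes_eq_eval_one_Q : ∀ (n : ℕ) (S : Finset ℕ), S.card = n → (0 : ℕ) ∉ S →
    (bSnakes S).card = (TangentNumbers.Q n).eval 1 := by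
  intro n
  induction n using Nat.strong_induction_on with
  | _ n ih =>
    intro S hSn hS
    cases n with
    | zero =>
        rw [Finset.card_eq_zero] at hSn
        subst hSn
        rw [bSnakes_empty, Finset.card_singleton]
        simp [TangentNumbers.Q]
    | succ n =>
        have hne : S.Nonempty := by rw [← Finset.card_pos, hSn]; exact Nat.succ_pos n
        have hMmem : S.max' hne ∈ S := S.max'_mem hne
        have hS'card : (S.erase (S.max' hne)).card = n := by
          rw [Finset.card_erase_of_mem hMmem, hSn, Nat.add_sub_cancel]
        rw [card_bSnakes_eq_sum hS hMmem (fun a ha => S.le_max' a ha), DerivativePolynomials.eval_one_Q_succ,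
          Finset.sum_congr rfl fun T hT => ?_]
        · rw [Finset.sum_powerset_apply_card
            (fun k => (TangentNumbers.Q k).eval 1 * (2 ^ (n - k) * eulerZigzag (n - k))), hS'card]
          exact Finset.sum_congr rfl fun k _ => by rw [smul_eq_mul, mul_assoc]
        · have hTS' : T ⊆ S.erase (S.max' hne) := Finset.mem_powerset.1 hT
          have hT0 : (0 : ℕ) ∉ T := fun h => hS (Finset.mem_of_mem_erase (hTS' h))
          have hD0 : (0 : ℕ) ∉ S.erase (S.max' hne) \ T := fun h =>
            hS (Finset.mem_of_mem_erase (Finset.mem_sdiff.1 h).1)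
          have hTlt : T.card < n + 1 :=
            Nat.lt_succ_of_le (hS'card ▸ Finset.card_le_card hTS')
          rw [ih T.card hTlt T rfl hT0, card_betaSnakes hD0, Finset.card_sdiff_of_subset hTS', hS'card]

/-- ★★★ **Theorem 4.2 (type `B`) on `{1, …, n}`**: `card Bₙ = Qₙ(1) = bₙ`, the Springer number of type `Bₙ`
(`1, 1, 3, 11, 57, 361, 2763, …`; Proposition 4.1 and `DerivativePolynomials.eval_one_Q_values`).
[cite: Hoffman1999DerivativePolynomials, §4 Theorem 4.2 («card Bₙ = Qₙ(1)») and Proposition 4.1 («bₙ = Qₙ(1)»); Arnold1992Snakes] -/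
theorem card_bSnakes_Icc (n : ℕ) : (bSnakes (Finset.Icc 1 n)).card = (TangentNumbers.Q n).eval 1 :=
  card_bSnakes_eq_eval_one_Q n _ (by rw [Nat.card_Icc, Nat.add_sub_cancel]) (by simp)

/-- Hoffman's recurrence as printed: `card B_{n+1} = Σ_r binom(n,r) card B_r card β_{n−r}`.
[cite: Hoffman1999DerivativePolynomials, §4 proof of Theorem 4.2 («Hence card B_{n+1} = Σ_{r=0}^{n} binom(n,r) card B_r card β_{n−r}»)] -/
theorem card_bSnakes_succ (n : ℕ) :
    (bSnakes (Finset.Icc 1 (n + 1))).card = ∑ r ∈ Finset.range (n + 1),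
      n.choose r * (bSnakes (Finset.Icc 1 r)).card * (betaSnakes (Finset.Icc 1 (n - r))).card := by
  simp only [card_bSnakes_Icc, card_betaSnakes_Icc, DerivativePolynomials.eval_one_P]
  exact DerivativePolynomials.eval_one_Q_succ n

/-- ★★ **Theorem 4.2, generating functions**: `b(t) = Σ card Bₙ tⁿ/n! = Q(1,t)` (`= 1/(cos t − sin t)`,
`DerivativePolynomials.egfQ_eq` / `egfQ_one_mul`). [cite: Hoffman1999DerivativePolynomials, §4 Theorem 4.2 («Then b(t) = Q(1,t)»)] -/
theorem egf_bSnakes :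
    (PowerSeries.mk fun n => ((bSnakes (Finset.Icc 1 n)).card : ℚ) / (Nat.factorial n : ℚ)) =
      DerivativePolynomials.egfQ (1 : ℚ) := by
  ext n
  rw [PowerSeries.coeff_mk, DerivativePolynomials.coeff_egfQ, DerivativePolynomials.aeval_one_nat,
    card_bSnakes_Icc]

/-- ★★ **Theorem 4.2, generating functions**: `β(t) = Σ card βₙ tⁿ/n! = P(1,t)` (`= (sin t + cos t)/(cos t − sin t)
= tan 2t + sec 2t`, `DerivativePolynomials.egfP_eq` / `egfP_one`). [cite: Hoffman1999DerivativePolynomials, §4 Theorem 4.2 («and β(t) = P(1,t)»)] -/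
theorem egf_betaSnakes :
    (PowerSeries.mk fun n => ((betaSnakes (Finset.Icc 1 n)).card : ℚ) / (Nat.factorial n : ℚ)) =
      DerivativePolynomials.egfP (1 : ℚ) := by
  ext n
  rw [PowerSeries.coeff_mk, DerivativePolynomials.coeff_egfP, DerivativePolynomials.aeval_one_nat,
    card_betaSnakes_Icc]

/-- The values `card B₀, …, card B₇ = 1, 1, 3, 11, 57, 361, 2763, 24611` and `card β₀, …, card β₆ =
1, 2, 4, 16, 80, 512, 3904`. [cite: Hoffman1999DerivativePolynomials, §4 Theorem 4.2 with §3 (the tables of [3] and [17]); Arnold1992Snakes] -/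
theorem card_snakes_values :
    [(bSnakes (Finset.Icc 1 0)).card, (bSnakes (Finset.Icc 1 1)).card, (bSnakes (Finset.Icc 1 2)).card,
      (bSnakes (Finset.Icc 1 3)).card, (bSnakes (Finset.Icc 1 4)).card, (bSnakes (Finset.Icc 1 5)).card,
      (bSnakes (Finset.Icc 1 6)).card, (bSnakes (Finset.Icc 1 7)).card] = [1, 1, 3, 11, 57, 361, 2763, 24611] ∧
    [(betaSnakes (Finset.Icc 1 0)).card, (betaSnakes (Finset.Icc 1 1)).card,
      (betaSnakes (Finset.Icc 1 2)).card, (betaSnakes (Finset.Icc 1 3)).card,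
      (betaSnakes (Finset.Icc 1 4)).card, (betaSnakes (Finset.Icc 1 5)).card,
      (betaSnakes (Finset.Icc 1 6)).card] = [1, 2, 4, 16, 80, 512, 3904] := by
  simp only [card_bSnakes_Icc, card_betaSnakes_Icc]
  exact ⟨DerivativePolynomials.eval_one_Q_values, DerivativePolynomials.eval_one_P_values⟩

end Snakes
end Literature.Combinatorics.Enumerative
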